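import Summits.QuantumFields.YangMills.Theorems.UnitScaleTiltHalvingP1FlatCoreDP1Target
import HarnessLib

/-!
# Line H (`BirthV10.stub_halvingStep`), J4∕J5 junction: trivial frames for a block-axial single-bar tower, and the (o)-target without `ν`

Crux `stmt-QuantumFields-19200` (`MinimiserStabilityRegPr`), line `birth_v10`, pillar P1♭ clause (o) (`HalvingP1FlatPillar.DP1Clause`).
J3's pre-gauge (✓`HalvingP1FlatCorePreGauge.exists_preGauge_flat`, clause (3)) puts the pre-gauged field `W₁ = (U♯)^{g}` in COMPLETE
BLOCK-AXIAL GAUGE below the top: every single-bar iterate `Ū₁^{(j)} = emlIterU j W₁`, `j < k`, has trivial centre-stair transporters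
inside each block.  Then ([Balaban1985Averaging] (89), (97)-(100), (110)):

* `vframeU_eq_one_of_stairs` — the block frame `v(X)(y) = exp[mean log X(Γ_{y,x_i})]` is `1` when the stairs are `1`;
* `dbarAvgU_eq_emlAvgU_of_stairs` — one double-bar step IS the single-bar step;
* `dbarIterU_eq_emlIterU_of_stairs`, `accFrames_eq_one_of_stairs` — down the tower: `W̿₁^{(j)} = Ū₁^{(j)}` and the accumulated frames
  `ν_j ≡ 1` for `j ≤ k`; `effGauge_step_of_stairs` — the effective-gauge recursion loses its right frame;
* `dp1Clause_of_effGauge_eq_axialT_eml` — THE (o)-TARGET in that gauge: chart gauge `u⁻¹ = g_k(y₀)⁻¹ · h′ · g`, and (o) follows from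
  `κ′_k(y) = v₀(Ū₁^{(k)}; y₀, y)` on the top cube (`P1FlatCoreDP1Target.dp1Clause_of_effGauge_eq_axialT_dbar` with `ν ≡ 1`).

Pure algebra along landed identities; no analysis.
-/

noncomputable section

open scoped BigOperators Matrix.Norms.L2Operator

namespace Summit.QuantumFields.YangMills.Theorems.P1FlatCoreAxialFrames

open Literature.MathematicalPhysics.QuantumFieldTheory.Balaban1983to89
open T4Continuum BlockAveraging ExpMeanLog MatrixLog
open T3ContinuumYM3Torus T3RegularMinimiser
open B5Eq118OneStroke (iterBlockOf)
open B6SectADomainsV1 (Domains)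
open B10Eq27TorusAxialLog (unitsField toUField gaugeActT gaugeActT_apply holT holT_one axialT rel)
open Summit.QuantumFields.YangMills.Theorems.Prop8Chart (emlAvgU emlIterU emlIterU_zero emlIterU_succ eml_const_one)
open Summit.QuantumFields.YangMills.Theorems.Prop8ChartDoubleBar (vframeU coe_vframeU dbarAvgU dbarAvgU_apply dbarIterU dbarIterU_zero
  dbarIterU_succ exists_accFrames_dbarIterU)
open Summit.QuantumFields.YangMills.Theorems.HalvingP1FlatPillar (DP1Clause)
open Summit.QuantumFields.YangMills.Theorems.P1FlatCoreDP1Target (dp1Clause_of_effGauge_eq_axialT_dbar)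

variable {P : Params} {𝔸 : Type*} [NormedRing 𝔸] [NormedAlgebra ℂ 𝔸] [CompleteSpace 𝔸]

/-! ## §1 One level: trivial stairs ⇒ trivial frame ⇒ double bar = single bar -/

section OneLevel

variable {j : ℕ}

/-- **TRIVIAL STAIRS ⇒ TRIVIAL FRAME**: if every centre-stair transporter of `X` inside the block of `y` is `1` (the block is in axial gauge
from its centre), the frame `v(X)(y) = exp[mean log 1] = 1`. [cite: Balaban1985Averaging, (110) p.34] -/
theorem vframeU_eq_one_of_stairs (X : GaugeField P j 𝔸ˣ) (y : Site P (j + 1))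
    (h : ∀ i : Idx P, holT X (emb y) (stairWord i.2.1 (off i.1)) = 1) : vframeU X y = 1 := by
  apply Units.ext
  rw [coe_vframeU, Units.val_one]
  have h1 : (fun i : Idx P => ((holT X (emb y) (stairWord i.2.1 (off i.1)) : 𝔸ˣ) : 𝔸)) = fun _ => 1 := by
    funext i; rw [h i, Units.val_one]
  rw [h1, eml_const_one]

/-- **ONE DOUBLE-BAR STEP IS THE SINGLE-BAR STEP** for a field whose blocks are axial from their centres: `U̿ = v⁻¹·Ū·v = Ū`.
[cite: Balaban1985Averaging, (89) p.31, (110) p.34] -/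
theorem dbarAvgU_eq_emlAvgU_of_stairs (X : GaugeField P j 𝔸ˣ)
    (h : ∀ (y : Site P (j + 1)) (i : Idx P), holT X (emb y) (stairWord i.2.1 (off i.1)) = 1) : dbarAvgU X = emlAvgU X := by
  funext c
  rw [dbarAvgU_apply, vframeU_eq_one_of_stairs X c.src (h c.src), vframeU_eq_one_of_stairs X c.tgt (h c.tgt), inv_one, one_mul,
    mul_one]

end OneLevel

/-! ## §2 Down the tower: `W̿^{(j)} = Ū^{(j)}` and `ν_j ≡ 1` -/

section Tower

/-- **DOUBLE BAR = SINGLE BAR DOWN A BLOCK-AXIAL TOWER**: if the single-bar iterates `Ū^{(j)}`, `j < k`, have trivial centre stairs in every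
block, then `W̿^{(j)} = Ū^{(j)}` for every `j ≤ k` (induction on (100)). [cite: Balaban1985Averaging, (97)-(100) p.32, (110) p.34] -/
theorem dbarIterU_eq_emlIterU_of_stairs (W : GaugeField P 0 𝔸ˣ) (k : ℕ)
    (h : ∀ j, j < k → ∀ (y : Site P (j + 1)) (i : Idx P), holT (emlIterU j W) (emb y) (stairWord i.2.1 (off i.1)) = 1) :
    ∀ j, j ≤ k → dbarIterU j W = emlIterU j W
  | 0, _ => by rw [dbarIterU_zero, emlIterU_zero]
  | j + 1, hj => by
    rw [dbarIterU_succ, emlIterU_succ, dbarIterU_eq_emlIterU_of_stairs W k h j (by omega),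
      dbarAvgU_eq_emlAvgU_of_stairs _ (h j (by omega))]

/-- **THE ACCUMULATED FRAMES ARE TRIVIAL** down a block-axial tower: `ν_j ≡ 1` for `j ≤ k` (recursion (97) with every factor `v = 1`).
[cite: Balaban1985Averaging, (97) p.32, (110) p.34] -/
theorem accFrames_eq_one_of_stairs (W : GaugeField P 0 𝔸ˣ) (ν : (j : ℕ) → Site P j → 𝔸ˣ) (hν0 : ∀ x, ν 0 x = 1)
    (hνs : ∀ (j : ℕ) (y : Site P (j + 1)), ν (j + 1) y = ν j (emb y) * vframeU (dbarIterU j W) y) (k : ℕ)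
    (h : ∀ j, j < k → ∀ (y : Site P (j + 1)) (i : Idx P), holT (emlIterU j W) (emb y) (stairWord i.2.1 (off i.1)) = 1) :
    ∀ j, j ≤ k → ∀ y : Site P j, ν j y = 1
  | 0, _, y => hν0 y
  | j + 1, hj, y => by
    rw [hνs j y, accFrames_eq_one_of_stairs W ν hν0 hνs k h j (by omega) (emb y),
      dbarIterU_eq_emlIterU_of_stairs W k h j (by omega), vframeU_eq_one_of_stairs _ y (h j (by omega) y), mul_one]

/-- **THE EFFECTIVE-GAUGE RECURSION WITHOUT ITS RIGHT FRAME**: down a block-axial tower the effective gauges of a correction `h` obey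
`κ_{j+1}(y) = v(Ū^{(j)}{}^{κ_j})(y)⁻¹ · κ_j(emb y)` for `j < k`. [cite: Balaban1985Averaging, (97)-(100) p.32, (110) p.34] -/
theorem effGauge_step_of_stairs (W : GaugeField P 0 𝔸ˣ) (κ : (i : ℕ) → GaugeTransf P i 𝔸ˣ)
    (hs : ∀ (i : ℕ) (y : Site P (i + 1)),
      κ (i + 1) y = (vframeU (gaugeActT (κ i) (dbarIterU i W)) y)⁻¹ * κ i (emb y) * vframeU (dbarIterU i W) y) (k : ℕ)
    (h : ∀ j, j < k → ∀ (y : Site P (j + 1)) (i : Idx P), holT (emlIterU j W) (emb y) (stairWord i.2.1 (off i.1)) = 1) :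
    ∀ j, j < k → ∀ y : Site P (j + 1), κ (j + 1) y = (vframeU (gaugeActT (κ j) (emlIterU j W)) y)⁻¹ * κ j (emb y) := by
  intro j hj y
  rw [hs j y, dbarIterU_eq_emlIterU_of_stairs W k h j hj.le, vframeU_eq_one_of_stairs _ y (h j hj y), mul_one]

end Tower

/-! ## §3 The (o)-target in the block-axial pre-gauge: no `ν`, constant `C = g_k(y₀)⁻¹` -/

section Target

open Summit.QuantumFields.YangMills.Theorems.FlatCubeSequenceAligned (cubeSeqMT3)

variable (F : T3Family) (n K : ℕ)

/-- **THE (o)-TARGET IN J3's GAUGE.**  Pre-gauge `g` with `W₁ = (U♯)^{g}` block-axial below the top (`hax`: trivial centre stairs of every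
`Ū₁^{(j)}`, `j < K-n`), descended pre-gauge `g_i = g ∘ emb^i`, correction `h′` with effective gauges `κ′_i`, chart gauge
`u⁻¹ = g_k(y₀)⁻¹ · h′ · g`, `y₀ = iterBlockOf (K-n) x`.  If `κ′_k(y) = v₀(Ū₁^{(k)}; y₀, y)` (axial gauge of the SINGLE-bar top field) at
the top sites of the window, then clause (o) holds. [cite: Balaban1985Averaging, (8) p.19, p.24, (89) p.31, (97)-(100) p.32, (110) p.34;
Balaban1985Variational, (20) p.281, (156) p.302] -/
theorem dp1Clause_of_effGauge_eq_axialT_eml (D : Domains (F.P K)) (x : Site (F.P K) 0)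
    (U : GaugeField (F.P K) 0 (Matrix.specialUnitaryGroup (Fin 2) ℂ)) (u : GaugeTransf (F.P K) 0 (Matrix.unitaryGroup (Fin 2) ℂ))
    (g h' : GaugeTransf (F.P K) 0 (Matrix (Fin 2) (Fin 2) ℂ)ˣ)
    (κ' : (i : ℕ) → GaugeTransf (F.P K) i (Matrix (Fin 2) (Fin 2) ℂ)ˣ) (h0' : κ' 0 = h')
    (hs' : ∀ (i : ℕ) (y : Site (F.P K) (i + 1)),
      κ' (i + 1) y = (vframeU (gaugeActT (κ' i) (dbarIterU i (gaugeActT g (unitsField (toUField U))))) y)⁻¹ * κ' i (emb y) *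
        vframeU (dbarIterU i (gaugeActT g (unitsField (toUField U)))) y)
    (gs : (i : ℕ) → GaugeTransf (F.P K) i (Matrix (Fin 2) (Fin 2) ℂ)ˣ) (hg0 : gs 0 = g)
    (hgs : ∀ (i : ℕ) (y : Site (F.P K) (i + 1)), gs (i + 1) y = gs i (emb y))
    (hax : ∀ j, j < K - n → ∀ (y : Site (F.P K) (j + 1)) (i : Idx (F.P K)),
      holT (emlIterU j (gaugeActT g (unitsField (toUField U)))) (emb y) (stairWord i.2.1 (off i.1)) = 1)
    {ε₀ : ℝ} (hε₀ : 0 < ε₀) (hε : 10 ^ 7 * (F.L : ℝ) ^ 3 * ε₀ ≤ 1) (hU : PlaqSmall (regThreshold F n K ε₀) U)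
    (hwrap : ∀ c : PBond (F.P K) (K - n), c.src ∈ D.Om (K - n) → c.tgt ∈ D.Om (K - n) →
      (rel (iterBlockOf (K - n) x) c.src c.dir + 1) * 2 ≤ ((F.P K).sitesPerDir (K - n) : ℤ))
    (hug : ∀ s, (Unitary.toUnits (u s))⁻¹ = (gs (K - n) (iterBlockOf (K - n) x))⁻¹ * h' s * g s)
    (hlam : ∀ y : Site (F.P K) (K - n), y ∈ D.Om (K - n) →
      κ' (K - n) y = axialT (emlIterU (K - n) (gaugeActT g (unitsField (toUField U)))) (iterBlockOf (K - n) x) y) :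
    DP1Clause F n K D x U u := by
  obtain ⟨ν, hν0, hνs, -⟩ := exists_accFrames_dbarIterU (gaugeActT g (unitsField (toUField U)))
  have hν1 : ν (K - n) (iterBlockOf (K - n) x) = 1 :=
    accFrames_eq_one_of_stairs _ ν hν0 hνs (K - n) hax (K - n) le_rfl _
  have hD : dbarIterU (K - n) (gaugeActT g (unitsField (toUField U))) = emlIterU (K - n) (gaugeActT g (unitsField (toUField U))) :=
    dbarIterU_eq_emlIterU_of_stairs _ (K - n) hax (K - n) le_rfl
  refine dp1Clause_of_effGauge_eq_axialT_dbar F n K D x U u g h' κ' h0' hs' ν hν0 hνs gs hg0 hgs hε₀ hε hU hwrap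
    (fun s => by rw [hug s, hν1, mul_one]) fun y hy => ?_
  rw [hlam y hy, hD]

end Target

end Summit.QuantumFields.YangMills.Theorems.P1FlatCoreAxialFrames

end
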